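import Literature.MathematicalPhysics.QuantumManyBody.BoseGasHardLayer
import Literature.MathematicalPhysics.QuantumManyBody.PeriodicConfigFourier
import HarnessLib

/-!
# Route BECSwapNoCatastrophe — absolute (symmetry-free) torus vocabulary with pair-dependent profiles (`AbsTorus`)

Route `BECSwapNoCatastrophe` (sub-problem `BoseEinsteinCondensation`), crux `TorusHalfSwapOverlap`
(stmt-AtomisticToContinuum-14393), line `registered` reshaped to v7 = the truncation split (lead c7, 2026-08-17).
Vocabulary for the sub-crux S `HalfSwapTruncationStability` (fixed-`n` two-copy Simon monotone convergence for the
half-swapped form on the ABSOLUTE class): the two-copy problem on `Config (n+1) × Config (n+1)` is read as an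
`(n+1)+(n+1)`-particle problem on the torus `(ℝ³/Lℤ³)^{2n+2}` WITHOUT Bose symmetry and with PAIR-DEPENDENT
profiles (bath–bath pairs inside a copy carry `v`, tagged–bath pairs carry `v/2`, the tagged pair and the cross
bath–bath pairs carry `0`). The one-copy maximal-form / truncation chain of the tree
(`PeriodicFormDomain` … `PeriodicMaxFormBoundHardCore`, `BoseGasHardLayer*`) is hard-wired to the Bose-symmetric
core and to ONE profile for all pairs; this file fixes the symmetry-free, pair-profile twins of its objects:

* `AbsAdm N L Ψ` — absolutely admissible `N`-body functions: `C¹`, `Lℤ³`-periodic in every particle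
  (`IsTorusPeriodic`), normalised on the cell `[0,L)^{3N}` (no permutation symmetry);
* `absEnergyW W L Ψ = ∫_{[0,L)^{3N}} |∇Ψ|² + W|Ψ|²` and `absGroundStateEnergyW W L = inf_{AbsAdm N L} absEnergyW W L`
  — the quadratic form of `-∑ⱼΔⱼ + W` on plain functions and the bottom of its (distinguishable-particle)
  spectrum, for an abstract weight `W : Config N → [0, ∞]`;
* `pairInteraction V L X = ∑_{i<j} (V i j)^per(xᵢ - xⱼ)` — the periodic interaction with a profile
  `V i j : ℝ → [0, ∞]` per pair (`periodicInteraction v L = pairInteraction (fun _ _ => v) L`);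
* `hardLayerP V L s`, `hardZoneP V L s` — hard layer / transition zone of the pair-profile interaction: some
  image radius `pairRad L X i j n` of a pair WITH hard radii lies within `s` (resp. within `3s` but not at) of a
  hard radius of ITS profile `V i j` (pairs whose profile has no hard radius never contribute — the guard
  `(hardRad (V i j)).Nonempty` replaces the global hypothesis `(hardRad v).Nonempty` of the one-copy files);
* `softProfile w θ` — `awayProfile w θ` if `w` has hard radii, else `w` itself (softening only where needed);
* `halfSwapCoeff n p q ∈ {0, 2⁻¹, 1}` and `halfSwapProfile v n p q = halfSwapCoeff n p q • v` — the profile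
  matrix of the half-swapped two-copy weight on `Fin ((n+1)+(n+1))` (first block = copy `X`, second = copy `Y`,
  slot `0` of each block = the tagged particle).

Design: plain `def`s over `Literature…BoseGas` vocabulary; every identification downstream is `rfl`/`Iff.rfl`.
Nothing here is claimed: the theorems live in the `…TorusHalfSwapOverlapAbs*` files of this directory.
-/

noncomputable section

open MeasureTheory Filter Set Metric
open scoped ENNReal NNReal BigOperators

namespace Summit.AtomisticToContinuum.BoseEinsteinCondensation.AbsTorus

open Literature.MathematicalPhysics.QuantumManyBody.BoseGas

/-! ## §1 The absolute class and the abstract-weight form -/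

/-- **Absolutely admissible** `N`-body functions on the torus of side `L`: `C¹`, `Lℤ³`-periodic in every
particle coordinate, normalised on the fundamental cell (NO permutation symmetry). -/
def AbsAdm (N : ℕ) (L : ℝ) (Ψ : Config N → ℂ) : Prop :=
  ContDiff ℝ 1 Ψ ∧ IsTorusPeriodic L Ψ ∧ ∫⁻ X in cellN N L, (‖Ψ X‖₊ : ℝ≥0∞) ^ 2 = 1

/-- The quadratic form `∫_{[0,L)^{3N}} |∇Ψ|² + W |Ψ|²` of `-∑ⱼΔⱼ + W` on a plain function (`⊤ · 0 = 0`). -/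
def absEnergyW {N : ℕ} (W : Config N → ℝ≥0∞) (L : ℝ) (Ψ : Config N → ℂ) : ℝ≥0∞ :=
  ∫⁻ X in cellN N L, kineticDensity Ψ X + W X * (‖Ψ X‖₊ : ℝ≥0∞) ^ 2

/-- The **absolute ground-state energy** of `-∑ⱼΔⱼ + W` on `(ℝ³/Lℤ³)^N`: infimum of `absEnergyW` over the
absolute class (`⊤` if the class is empty, e.g. `L ≤ 0`). -/
def absGroundStateEnergyW {N : ℕ} (W : Config N → ℝ≥0∞) (L : ℝ) : ℝ≥0∞ :=
  ⨅ (Ψ : Config N → ℂ) (_ : AbsAdm N L Ψ), absEnergyW W L Ψ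

/-- Unfolding `AbsAdm`. [folklore] -/
theorem absAdm_iff {N : ℕ} {L : ℝ} {Ψ : Config N → ℂ} :
    AbsAdm N L Ψ ↔ ContDiff ℝ 1 Ψ ∧ IsTorusPeriodic L Ψ ∧ ∫⁻ X in cellN N L, (‖Ψ X‖₊ : ℝ≥0∞) ^ 2 = 1 :=
  Iff.rfl

/-- Unfolding `absEnergyW`. [folklore] -/
theorem absEnergyW_def {N : ℕ} (W : Config N → ℝ≥0∞) (L : ℝ) (Ψ : Config N → ℂ) :
    absEnergyW W L Ψ = ∫⁻ X in cellN N L, kineticDensity Ψ X + W X * (‖Ψ X‖₊ : ℝ≥0∞) ^ 2 := rfl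

/-- Unfolding `absGroundStateEnergyW`. [folklore] -/
theorem absGroundStateEnergyW_def {N : ℕ} (W : Config N → ℝ≥0∞) (L : ℝ) :
    absGroundStateEnergyW W L = ⨅ (Ψ : Config N → ℂ) (_ : AbsAdm N L Ψ), absEnergyW W L Ψ := rfl

/-- Variational principle: the absolute ground-state energy is below the form of every admissible function. -/
theorem absGroundStateEnergyW_le {N : ℕ} {W : Config N → ℝ≥0∞} {L : ℝ} {Ψ : Config N → ℂ} (hΨ : AbsAdm N L Ψ) :
    absGroundStateEnergyW W L ≤ absEnergyW W L Ψ :=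
  iInf₂_le (f := fun (Ψ : Config N → ℂ) (_ : AbsAdm N L Ψ) => absEnergyW W L Ψ) Ψ hΨ

/-- Monotonicity in the weight (statewise, hence for the infimum). -/
theorem absEnergyW_mono {N : ℕ} {W₁ W₂ : Config N → ℝ≥0∞} (h : ∀ X, W₁ X ≤ W₂ X) (L : ℝ) (Ψ : Config N → ℂ) :
    absEnergyW W₁ L Ψ ≤ absEnergyW W₂ L Ψ :=
  lintegral_mono fun X => add_le_add le_rfl (mul_le_mul' (h X) le_rfl)

/-- Monotonicity of the absolute ground-state energy in the weight. [folklore] -/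
theorem absGroundStateEnergyW_mono {N : ℕ} {W₁ W₂ : Config N → ℝ≥0∞} (h : ∀ X, W₁ X ≤ W₂ X) (L : ℝ) :
    absGroundStateEnergyW W₁ L ≤ absGroundStateEnergyW W₂ L :=
  iInf₂_mono fun Ψ _ => absEnergyW_mono h L Ψ

/-! ## §2 Pair-dependent profiles -/

/-- The periodic interaction with a profile per pair: `∑_{i<j} ∑_{n ∈ ℤ³} (V i j)(|xᵢ - xⱼ - Ln|)`. -/
def pairInteraction {N : ℕ} (V : Fin N → Fin N → ℝ → ℝ≥0∞) (L : ℝ) (X : Config N) : ℝ≥0∞ :=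
  ∑ i : Fin N, ∑ j : Fin N with i < j, periodizedPotential (V i j) L (X i - X j)

/-- Unfolding `pairInteraction`. [folklore] -/
theorem pairInteraction_def {N : ℕ} (V : Fin N → Fin N → ℝ → ℝ≥0∞) (L : ℝ) (X : Config N) :
    pairInteraction V L X = ∑ i : Fin N, ∑ j : Fin N with i < j, periodizedPotential (V i j) L (X i - X j) := rfl

/-- One profile for all pairs is the tree's `periodicInteraction` (by `rfl`). -/
theorem pairInteraction_const {N : ℕ} (v : ℝ → ℝ≥0∞) (L : ℝ) (X : Config N) :
    pairInteraction (fun _ _ => v) L X = periodicInteraction v L X := rfl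

/-- The **hard layer** of width `s` of a pair-profile interaction: some image radius of a pair whose profile HAS
hard radii lies within `s` of one of them. -/
def hardLayerP {N : ℕ} (V : Fin N → Fin N → ℝ → ℝ≥0∞) (L s : ℝ) : Set (Config N) :=
  {X | ∃ (i j : Fin N) (n : Fin 3 → ℤ), i ≠ j ∧ (hardRad (V i j)).Nonempty ∧
    infDist (pairRad L X i j n) (hardRad (V i j)) ≤ s}

/-- The **transition zone** of width `3s`: some image radius of a pair with hard radii is within `3s` of, but
not at, a hard radius of its profile. -/
def hardZoneP {N : ℕ} (V : Fin N → Fin N → ℝ → ℝ≥0∞) (L s : ℝ) : Set (Config N) :=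
  {X | ∃ (i j : Fin N) (n : Fin 3 → ℤ), i ≠ j ∧ (hardRad (V i j)).Nonempty ∧
    0 < infDist (pairRad L X i j n) (hardRad (V i j)) ∧ infDist (pairRad L X i j n) (hardRad (V i j)) ≤ 3 * s}

/-- Membership in the pair-profile hard layer. [folklore] -/
theorem mem_hardLayerP_iff {N : ℕ} {V : Fin N → Fin N → ℝ → ℝ≥0∞} {L s : ℝ} {X : Config N} :
    X ∈ hardLayerP V L s ↔ ∃ (i j : Fin N) (n : Fin 3 → ℤ), i ≠ j ∧ (hardRad (V i j)).Nonempty ∧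
      infDist (pairRad L X i j n) (hardRad (V i j)) ≤ s := Iff.rfl

/-- Membership in the pair-profile transition zone. [folklore] -/
theorem mem_hardZoneP_iff {N : ℕ} {V : Fin N → Fin N → ℝ → ℝ≥0∞} {L s : ℝ} {X : Config N} :
    X ∈ hardZoneP V L s ↔ ∃ (i j : Fin N) (n : Fin 3 → ℤ), i ≠ j ∧ (hardRad (V i j)).Nonempty ∧
      0 < infDist (pairRad L X i j n) (hardRad (V i j)) ∧ infDist (pairRad L X i j n) (hardRad (V i j)) ≤ 3 * s :=
  Iff.rfl

open Classical in
/-- The **softened profile**: switch `w` off within `θ` of its hard radii if it has any, otherwise keep it. -/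
def softProfile (w : ℝ → ℝ≥0∞) (θ : ℝ) : ℝ → ℝ≥0∞ :=
  if (hardRad w).Nonempty then awayProfile w θ else w

/-- A profile with hard radii is softened to `awayProfile`. [folklore] -/
theorem softProfile_of_nonempty {w : ℝ → ℝ≥0∞} (h : (hardRad w).Nonempty) (θ : ℝ) :
    softProfile w θ = awayProfile w θ := by
  simp [softProfile, h]

/-- A profile without hard radii is kept. [folklore] -/
theorem softProfile_of_not_nonempty {w : ℝ → ℝ≥0∞} (h : ¬ (hardRad w).Nonempty) (θ : ℝ) :
    softProfile w θ = w := by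
  simp [softProfile, h]

/-! ## §3 The half-swapped two-copy weight as a pair-profile interaction of `(n+1)+(n+1)` particles -/

/-- Coefficients of the half-swapped weight on block/slot-decoded indices: inside a block (a copy) a pair of bath
slots carries `1` and a pair containing the tagged slot `0` carries `2⁻¹`; across the blocks only the pairs
(tagged, bath) carry `2⁻¹`; the tagged pair `(a, b)` and cross bath–bath pairs carry `0`. -/
def halfSwapCoeffSum (n : ℕ) : Fin (n + 1) ⊕ Fin (n + 1) → Fin (n + 1) ⊕ Fin (n + 1) → ℝ≥0∞
  | Sum.inl i, Sum.inl j => if i = 0 ∧ j = 0 then 0 else if i = 0 ∨ j = 0 then 2⁻¹ else 1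
  | Sum.inr i, Sum.inr j => if i = 0 ∧ j = 0 then 0 else if i = 0 ∨ j = 0 then 2⁻¹ else 1
  | Sum.inl i, Sum.inr j => if (i = 0 ∧ j ≠ 0) ∨ (i ≠ 0 ∧ j = 0) then 2⁻¹ else 0
  | Sum.inr i, Sum.inl j => if (i = 0 ∧ j ≠ 0) ∨ (i ≠ 0 ∧ j = 0) then 2⁻¹ else 0

/-- The coefficient matrix of the half-swapped weight on `Fin ((n+1)+(n+1))` (blocks via `finSumFinEquiv`). -/
def halfSwapCoeff (n : ℕ) (p q : Fin ((n + 1) + (n + 1))) : ℝ≥0∞ :=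
  halfSwapCoeffSum n (finSumFinEquiv.symm p) (finSumFinEquiv.symm q)

/-- The **profile matrix of the half-swapped weight**: pair `(p, q)` interacts through `halfSwapCoeff n p q • v`. -/
def halfSwapProfile (v : ℝ → ℝ≥0∞) (n : ℕ) (p q : Fin ((n + 1) + (n + 1))) : ℝ → ℝ≥0∞ :=
  fun r => halfSwapCoeff n p q * v r

/-- Unfolding `halfSwapProfile`. [folklore] -/
theorem halfSwapProfile_apply (v : ℝ → ℝ≥0∞) (n : ℕ) (p q : Fin ((n + 1) + (n + 1))) (r : ℝ) :
    halfSwapProfile v n p q r = halfSwapCoeff n p q * v r := rfl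

/-- Coefficients inside the first copy. [folklore] -/
@[simp] theorem halfSwapCoeff_castAdd_castAdd (n : ℕ) (i j : Fin (n + 1)) :
    halfSwapCoeff n (Fin.castAdd (n + 1) i) (Fin.castAdd (n + 1) j) =
      if i = 0 ∧ j = 0 then 0 else if i = 0 ∨ j = 0 then 2⁻¹ else 1 := by
  rw [halfSwapCoeff, finSumFinEquiv_symm_apply_castAdd, finSumFinEquiv_symm_apply_castAdd, halfSwapCoeffSum]

/-- Coefficients inside the second copy. [folklore] -/
@[simp] theorem halfSwapCoeff_natAdd_natAdd (n : ℕ) (i j : Fin (n + 1)) :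
    halfSwapCoeff n (Fin.natAdd (n + 1) i) (Fin.natAdd (n + 1) j) =
      if i = 0 ∧ j = 0 then 0 else if i = 0 ∨ j = 0 then 2⁻¹ else 1 := by
  rw [halfSwapCoeff, finSumFinEquiv_symm_apply_natAdd, finSumFinEquiv_symm_apply_natAdd, halfSwapCoeffSum]

/-- Cross coefficients (first copy, second copy). [folklore] -/
@[simp] theorem halfSwapCoeff_castAdd_natAdd (n : ℕ) (i j : Fin (n + 1)) :
    halfSwapCoeff n (Fin.castAdd (n + 1) i) (Fin.natAdd (n + 1) j) =
      if (i = 0 ∧ j ≠ 0) ∨ (i ≠ 0 ∧ j = 0) then 2⁻¹ else 0 := by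
  rw [halfSwapCoeff, finSumFinEquiv_symm_apply_castAdd, finSumFinEquiv_symm_apply_natAdd, halfSwapCoeffSum]

/-- Cross coefficients (second copy, first copy). [folklore] -/
@[simp] theorem halfSwapCoeff_natAdd_castAdd (n : ℕ) (i j : Fin (n + 1)) :
    halfSwapCoeff n (Fin.natAdd (n + 1) i) (Fin.castAdd (n + 1) j) =
      if (i = 0 ∧ j ≠ 0) ∨ (i ≠ 0 ∧ j = 0) then 2⁻¹ else 0 := by
  rw [halfSwapCoeff, finSumFinEquiv_symm_apply_natAdd, finSumFinEquiv_symm_apply_castAdd, halfSwapCoeffSum]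

/-- The coefficient matrix is symmetric. -/
theorem halfSwapCoeffSum_comm (n : ℕ) (a b : Fin (n + 1) ⊕ Fin (n + 1)) :
    halfSwapCoeffSum n a b = halfSwapCoeffSum n b a := by
  rcases a with i | i <;> rcases b with j | j <;> simp only [halfSwapCoeffSum] <;> split_ifs <;>
    first | rfl | (exfalso; tauto)

/-- The coefficient matrix on `Fin ((n+1)+(n+1))` is symmetric. [folklore] -/
theorem halfSwapCoeff_comm (n : ℕ) (p q : Fin ((n + 1) + (n + 1))) :
    halfSwapCoeff n p q = halfSwapCoeff n q p :=
  halfSwapCoeffSum_comm n _ _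

/-- The profile matrix is symmetric. [folklore] -/
theorem halfSwapProfile_comm (v : ℝ → ℝ≥0∞) (n : ℕ) (p q : Fin ((n + 1) + (n + 1))) :
    halfSwapProfile v n p q = halfSwapProfile v n q p := by
  funext r; rw [halfSwapProfile_apply, halfSwapProfile_apply, halfSwapCoeff_comm]

/-- The coefficients are at most `1`. -/
theorem halfSwapCoeffSum_le_one (n : ℕ) (a b : Fin (n + 1) ⊕ Fin (n + 1)) : halfSwapCoeffSum n a b ≤ 1 := by
  have h2 : (2 : ℝ≥0∞)⁻¹ ≤ 1 := ENNReal.inv_le_one.2 one_le_two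
  rcases a with i | i <;> rcases b with j | j <;> simp only [halfSwapCoeffSum] <;> split_ifs
  all_goals first | exact bot_le | exact le_rfl | exact h2

/-- The coefficients on `Fin ((n+1)+(n+1))` are at most `1`. [folklore] -/
theorem halfSwapCoeff_le_one (n : ℕ) (p q : Fin ((n + 1) + (n + 1))) : halfSwapCoeff n p q ≤ 1 :=
  halfSwapCoeffSum_le_one n _ _

/-- Each entry of the profile matrix is a repulsive finite-range profile when `v` is. -/
theorem isRepulsiveFiniteRange_halfSwapProfile {v : ℝ → ℝ≥0∞} (hv : IsRepulsiveFiniteRange v) (n : ℕ)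
    (p q : Fin ((n + 1) + (n + 1))) : IsRepulsiveFiniteRange (halfSwapProfile v n p q) := by
  refine ⟨measurable_const.mul hv.1, ?_⟩
  obtain ⟨R₀, hR₀⟩ := hv.2
  exact ⟨R₀, fun r hr => by rw [halfSwapProfile_apply, hR₀ r hr, mul_zero]⟩

end Summit.AtomisticToContinuum.BoseEinsteinCondensation.AbsTorus

end
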